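import Summits.QuantumFields.YangMills.Theorems.FradkinShenkerFlowStrongPinningPoincareHeatBathPoincare
import Summits.QuantumFields.YangMills.Theorems.FradkinShenkerFlowSusceptibilityToPoincareHaarResample

/-!
# From Lipschitz observables to all bounded measurable observables

Fourth file of the abstract part of `StrongPinningPoincare`: both sides of the heat-bath
Poincaré inequality are Lipschitz for the `L¹(μ)` distance on functions bounded by a common
constant, and on a compact metrisable configuration space every bounded measurable function is an
`L¹(μ)` limit of bounded, coordinatewise Lipschitz ones (bounded continuous approximation from
Mathlib, then inf-convolution with `L ∑ᵢ d(xᵢ, yᵢ)`). Hence a Poincaré inequality proved for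
coordinatewise Lipschitz observables holds for all bounded measurable ones.
-/

noncomputable section

open MeasureTheory Function Real Filter
open scoped ENNReal Topology

namespace Summit.QuantumFields.YangMills.Theorems.StrongPinningPoincare

namespace HeatBath

/-! ### `L¹`-continuity of the two sides -/

section Continuity

variable {ι : Type*} [Fintype ι] [DecidableEq ι] {E : Type*} [MeasurableSpace E]
  (lam : Measure E) [IsProbabilityMeasure lam] {V : (ι → E) → ℝ}

/-- An elementary bound: if `|a|, |b|, |a'|, |b'| ≤ M` then
`|(a - a')² - (b - b')²| ≤ 4M (|a - b| + |a' - b'|)`. [folklore] -/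
theorem abs_sq_sub_sq_le {a a' b b' M : ℝ} (ha : |a| ≤ M) (ha' : |a'| ≤ M) (hb : |b| ≤ M)
    (hb' : |b'| ≤ M) : |(a - a') ^ 2 - (b - b') ^ 2| ≤ 4 * M * (|a - b| + |a' - b'|) := by
  have h1 : (a - a') ^ 2 - (b - b') ^ 2 = ((a - b) - (a' - b')) * ((a - a') + (b - b')) := by ring
  rw [h1, abs_mul]
  have h2 : |(a - a') + (b - b')| ≤ 4 * M := by
    calc |(a - a') + (b - b')| ≤ |a - a'| + |b - b'| := abs_add_le _ _
      _ ≤ (|a| + |a'|) + (|b| + |b'|) := add_le_add (abs_sub _ _) (abs_sub _ _)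
      _ ≤ (M + M) + (M + M) := add_le_add (add_le_add ha ha') (add_le_add hb hb')
      _ = 4 * M := by ring
  have h3 : |(a - b) - (a' - b')| ≤ |a - b| + |a' - b'| := abs_sub _ _
  calc |(a - b) - (a' - b')| * |(a - a') + (b - b')| ≤ (|a - b| + |a' - b'|) * (4 * M) :=
        mul_le_mul h3 h2 (abs_nonneg _) (by positivity)
    _ = 4 * M * (|a - b| + |a' - b'|) := by ring

omit [DecidableEq ι] in
/-- **`L¹`-continuity of the variance on bounded functions**: for `|F|, |G| ≤ M` on a
probability space, `|Var F - Var G| ≤ 8 M ∫ |F - G|`. [folklore] -/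
theorem abs_variance_sub_le (hV : Measurable V) {B : ℝ} (hB : ∀ x, |V x| ≤ B)
    {F G : (ι → E) → ℝ} (hF : Measurable F) (hG : Measurable G) {M : ℝ} (hMF : ∀ x, |F x| ≤ M)
    (hMG : ∀ x, |G x| ≤ M) :
    |ProbabilityTheory.variance F ((Measure.pi fun _ : ι => lam).tilted V) -
        ProbabilityTheory.variance G ((Measure.pi fun _ : ι => lam).tilted V)| ≤
      8 * M * ∫ x, |F x - G x| ∂((Measure.pi fun _ : ι => lam).tilted V) := by
  haveI := isProbabilityMeasure_gibbs lam hV hB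
  set μ := (Measure.pi fun _ : ι => lam).tilted V with hμ
  have hFi : Integrable F μ := integrable_of_abs_le hF hMF
  have hGi : Integrable G μ := integrable_of_abs_le hG hMG
  have hmean : ∀ {H : (ι → E) → ℝ}, (∀ x, |H x| ≤ M) → |∫ x, H x ∂μ| ≤ M := fun {H} hH => by
    have h := norm_integral_le_of_norm_le_const (μ := μ) (f := H) (C := M)
      (ae_of_all _ fun x => by rw [Real.norm_eq_abs]; exact hH x)
    simpa only [probReal_univ, mul_one, Real.norm_eq_abs] using h
  set mF := ∫ x, F x ∂μ with hmF
  set mG := ∫ x, G x ∂μ with hmG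
  have hη : |mF - mG| ≤ ∫ x, |F x - G x| ∂μ := by
    rw [hmF, hmG, ← integral_sub hFi hGi]
    exact abs_integral_le_integral_abs
  rw [ProbabilityTheory.variance_eq_integral hF.aemeasurable,
    ProbabilityTheory.variance_eq_integral hG.aemeasurable]
  have i1 : Integrable (fun x => (F x - mF) ^ 2) μ := by
    refine integrable_of_abs_le ((hF.sub_const _).pow_const 2) (C := (M + M) ^ 2) fun x => ?_
    rw [abs_pow]
    exact pow_le_pow_left₀ (abs_nonneg _) ((abs_sub _ _).trans (add_le_add (hMF x) (hmean hMF))) 2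
  have i2 : Integrable (fun x => (G x - mG) ^ 2) μ := by
    refine integrable_of_abs_le ((hG.sub_const _).pow_const 2) (C := (M + M) ^ 2) fun x => ?_
    rw [abs_pow]
    exact pow_le_pow_left₀ (abs_nonneg _) ((abs_sub _ _).trans (add_le_add (hMG x) (hmean hMG))) 2
  change |∫ x, (F x - mF) ^ 2 ∂μ - ∫ x, (G x - mG) ^ 2 ∂μ| ≤ 8 * M * ∫ x, |F x - G x| ∂μ
  rw [← integral_sub i1 i2]
  refine (abs_integral_le_integral_abs).trans ?_
  have hpt : ∀ x, |(F x - mF) ^ 2 - (G x - mG) ^ 2| ≤ 4 * M * (|F x - G x| + |mF - mG|) :=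
    fun x => abs_sq_sub_sq_le (hMF x) (hmean hMF) (hMG x) (hmean hMG)
  have i3 : Integrable (fun x => |F x - G x|) μ := (hFi.sub hGi).abs
  have i4 : Integrable (fun x => 4 * M * (|F x - G x| + |mF - mG|)) μ :=
    ((i3.add (integrable_const _)).const_mul _)
  calc ∫ x, |(F x - mF) ^ 2 - (G x - mG) ^ 2| ∂μ ≤ ∫ x, 4 * M * (|F x - G x| + |mF - mG|) ∂μ :=
        integral_mono_of_nonneg (ae_of_all _ fun x => abs_nonneg _) i4 (ae_of_all _ hpt)
    _ = 4 * M * (∫ x, |F x - G x| ∂μ + |mF - mG|) := by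
        rw [integral_const_mul, integral_add i3 (integrable_const _), integral_const, probReal_univ,
          one_smul]
    _ ≤ 4 * M * (∫ x, |F x - G x| ∂μ + ∫ x, |F x - G x| ∂μ) := by
        have hM0 : 0 ≤ M := le_trans (abs_nonneg _) (hmean hMF)
        exact mul_le_mul_of_nonneg_left (add_le_add le_rfl hη) (by positivity)
    _ = 8 * M * ∫ x, |F x - G x| ∂μ := by ring

/-- **`L¹`-continuity of the one-site Dirichlet forms on bounded functions**: for `|F|, |G| ≤ M`,
`|Qᵢ(F) - Qᵢ(G)| ≤ 8 M ∫ |F - G| dμ`, where `Qᵢ(F) = ∫∫ (F x − F(x[i↦e]))² dν_i^x dμ` (the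
resampled copy contributes `∫ P_i |F - G| dμ = ∫ |F - G| dμ` by the DLR identity). [folklore] -/
theorem abs_dirichlet_sub_le (hV : Measurable V) {B : ℝ} (hB : ∀ x, |V x| ≤ B) (i : ι)
    {F G : (ι → E) → ℝ} (hF : Measurable F) (hG : Measurable G) {M : ℝ} (hMF : ∀ x, |F x| ≤ M)
    (hMG : ∀ x, |G x| ≤ M) :
    |∫ x, ∫ e, (F x - F (update x i e)) ^ 2 ∂(lam.tilted fun e => V (update x i e))
          ∂((Measure.pi fun _ : ι => lam).tilted V) -
        ∫ x, ∫ e, (G x - G (update x i e)) ^ 2 ∂(lam.tilted fun e => V (update x i e))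
          ∂((Measure.pi fun _ : ι => lam).tilted V)| ≤
      8 * M * ∫ x, |F x - G x| ∂((Measure.pi fun _ : ι => lam).tilted V) := by
  haveI := isProbabilityMeasure_gibbs lam hV hB
  set μ := (Measure.pi fun _ : ι => lam).tilted V with hμ
  have hM0 : ∀ x : ι → E, 0 ≤ M := fun x => (abs_nonneg _).trans (hMF x)
  -- joint measurability of the two integrands and of `|F - G|` resampled
  have hsqF : Measurable fun p : (ι → E) × E => (F p.1 - F (update p.1 i p.2)) ^ 2 :=
    ((hF.comp measurable_fst).sub (hF.comp measurable_update')).pow_const 2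
  have hsqG : Measurable fun p : (ι → E) × E => (G p.1 - G (update p.1 i p.2)) ^ 2 :=
    ((hG.comp measurable_fst).sub (hG.comp measurable_update')).pow_const 2
  have hVm : Measurable fun p : (ι → E) × E => V (update p.1 i p.2) := hV.comp measurable_update'
  have hIF : Measurable fun x => ∫ e, (F x - F (update x i e)) ^ 2
      ∂(lam.tilted fun e => V (update x i e)) :=
    SusceptibilityToPoincare.HaarResample.measurable_integral_tilted hVm hsqF
  have hIG : Measurable fun x => ∫ e, (G x - G (update x i e)) ^ 2
      ∂(lam.tilted fun e => V (update x i e)) :=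
    SusceptibilityToPoincare.HaarResample.measurable_integral_tilted hVm hsqG
  have hbd : ∀ {H : (ι → E) → ℝ}, (∀ x, |H x| ≤ M) → ∀ (x : ι → E) (e : E),
      |(H x - H (update x i e)) ^ 2| ≤ (M + M) ^ 2 := fun {H} hH x e => by
    rw [abs_pow]
    exact pow_le_pow_left₀ (abs_nonneg _) ((abs_sub _ _).trans (add_le_add (hH _) (hH _))) 2
  have hIFb : ∀ x, |∫ e, (F x - F (update x i e)) ^ 2 ∂(lam.tilted fun e => V (update x i e))|
      ≤ (M + M) ^ 2 := fun x => by
    haveI := isProbabilityMeasure_heatBath lam hV hB x i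
    have h := norm_integral_le_of_norm_le_const (μ := lam.tilted fun e => V (update x i e))
      (f := fun e => (F x - F (update x i e)) ^ 2) (C := (M + M) ^ 2)
      (ae_of_all _ fun e => by rw [Real.norm_eq_abs]; exact hbd hMF x e)
    simpa only [probReal_univ, mul_one, Real.norm_eq_abs] using h
  have hIGb : ∀ x, |∫ e, (G x - G (update x i e)) ^ 2 ∂(lam.tilted fun e => V (update x i e))|
      ≤ (M + M) ^ 2 := fun x => by
    haveI := isProbabilityMeasure_heatBath lam hV hB x i
    have h := norm_integral_le_of_norm_le_const (μ := lam.tilted fun e => V (update x i e))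
      (f := fun e => (G x - G (update x i e)) ^ 2) (C := (M + M) ^ 2)
      (ae_of_all _ fun e => by rw [Real.norm_eq_abs]; exact hbd hMG x e)
    simpa only [probReal_univ, mul_one, Real.norm_eq_abs] using h
  rw [← integral_sub (integrable_of_abs_le hIF hIFb) (integrable_of_abs_le hIG hIGb)]
  refine (abs_integral_le_integral_abs).trans ?_
  -- pointwise in `x`: difference of the inner integrals
  set H : (ι → E) → ℝ := fun x => |F x - G x| with hH
  have hHm : Measurable H := (hF.sub hG).abs
  have hHb : ∀ x, |H x| ≤ M + M := fun x => by
    simp only [hH, abs_abs]; exact (abs_sub _ _).trans (add_le_add (hMF x) (hMG x))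
  have hpt : ∀ x, |∫ e, (F x - F (update x i e)) ^ 2 ∂(lam.tilted fun e => V (update x i e)) -
      ∫ e, (G x - G (update x i e)) ^ 2 ∂(lam.tilted fun e => V (update x i e))| ≤
      4 * M * (H x + ∫ e, H (update x i e) ∂(lam.tilted fun e => V (update x i e))) := fun x => by
    haveI := isProbabilityMeasure_heatBath lam hV hB x i
    have j1 : Integrable (fun e => (F x - F (update x i e)) ^ 2)
        (lam.tilted fun e => V (update x i e)) :=
      integrable_of_abs_le (hsqF.comp (measurable_prodMk_left (x := x))) fun e => hbd hMF x e
    have j2 : Integrable (fun e => (G x - G (update x i e)) ^ 2)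
        (lam.tilted fun e => V (update x i e)) :=
      integrable_of_abs_le (hsqG.comp (measurable_prodMk_left (x := x))) fun e => hbd hMG x e
    have j3 : Integrable (fun e => H (update x i e)) (lam.tilted fun e => V (update x i e)) :=
      integrable_of_abs_le (hHm.comp (measurable_update x)) fun e => hHb _
    rw [← integral_sub j1 j2]
    refine (abs_integral_le_integral_abs).trans ?_
    have hq : ∀ e, |(F x - F (update x i e)) ^ 2 - (G x - G (update x i e)) ^ 2| ≤
        4 * M * (H x + H (update x i e)) := fun e =>
      abs_sq_sub_sq_le (hMF _) (hMF _) (hMG _) (hMG _)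
    have j4 : Integrable (fun e => 4 * M * (H x + H (update x i e)))
        (lam.tilted fun e => V (update x i e)) := ((integrable_const _).add j3).const_mul _
    calc _ ≤ ∫ e, 4 * M * (H x + H (update x i e)) ∂(lam.tilted fun e => V (update x i e)) :=
          integral_mono_of_nonneg (ae_of_all _ fun e => abs_nonneg _) j4 (ae_of_all _ hq)
      _ = 4 * M * (H x + ∫ e, H (update x i e) ∂(lam.tilted fun e => V (update x i e))) := by
          rw [integral_const_mul, integral_add (integrable_const _) j3, integral_const,
            probReal_univ, one_smul]
  have hPH : Measurable fun x => ∫ e, H (update x i e) ∂(lam.tilted fun e => V (update x i e)) :=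
    measurable_heatBath lam hV i hHm
  have hPHb : ∀ x, |∫ e, H (update x i e) ∂(lam.tilted fun e => V (update x i e))| ≤ M + M :=
    fun x => abs_heatBath_le lam hV hB x i hHb
  have k1 : Integrable H μ := integrable_of_abs_le hHm hHb
  have k2 : Integrable (fun x => ∫ e, H (update x i e) ∂(lam.tilted fun e => V (update x i e))) μ :=
    integrable_of_abs_le hPH hPHb
  have k3 : Integrable (fun x => 4 * M *
      (H x + ∫ e, H (update x i e) ∂(lam.tilted fun e => V (update x i e)))) μ :=
    ((k1.add k2).const_mul _)
  calc _ ≤ ∫ x, 4 * M * (H x + ∫ e, H (update x i e) ∂(lam.tilted fun e => V (update x i e))) ∂μ :=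
        integral_mono_of_nonneg (ae_of_all _ fun x => abs_nonneg _) k3 (ae_of_all _ hpt)
    _ = 4 * M * (∫ x, H x ∂μ + ∫ x, H x ∂μ) := by
        rw [integral_const_mul, integral_add k1 k2, integral_heatBath lam hV hB i hHm hHb]
    _ = 8 * M * ∫ x, |F x - G x| ∂μ := by simp only [hH]; ring

end Continuity

/-! ### Lipschitz approximation of continuous functions on a compact configuration space -/

section LipApprox

variable {ι : Type*} [Fintype ι] [DecidableEq ι] {E : Type*} [TopologicalSpace E]
  [CompactSpace E]

/-- **Inf-convolution**: on the compact space `ι → E`, a continuous `G` is uniformly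
approximated (within any `δ > 0`) by a continuous function that is `L`-Lipschitz for the weight
`∑ᵢ d(xᵢ, yᵢ)` — hence coordinatewise `L`-Lipschitz for `d` — for some `L ≥ 0`, provided `d` is
a continuous symmetric nonnegative weight with `d e e = 0`, the triangle inequality and
`d e e' = 0 → e = e'` (take `H x = inf_y (G y + L ∑ᵢ d(xᵢ, yᵢ))`; `L` from compactness of
`{G y + δ ≤ G x}`, on which the weight is bounded below). [folklore] -/
theorem exists_lipAt_approx (d : E → E → ℝ) (hdc : Continuous fun p : E × E => d p.1 p.2)
    (hd0 : ∀ e, d e e = 0) (hdnn : ∀ e e', 0 ≤ d e e') (hdsymm : ∀ e e', d e e' = d e' e)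
    (hdtri : ∀ a b c, d a c ≤ d a b + d b c) (hdsep : ∀ e e', d e e' = 0 → e = e')
    {G : (ι → E) → ℝ} (hG : Continuous G) {MG : ℝ} (hMG0 : 0 ≤ MG) (hMG : ∀ x, |G x| ≤ MG)
    {δ : ℝ} (hδ : 0 < δ) :
    ∃ (L : ℝ) (H : (ι → E) → ℝ), 0 ≤ L ∧ Continuous H ∧ (∀ x, |H x - G x| ≤ δ) ∧
      ∀ (x : ι → E) (j : ι) (a : E), |H (update x j a) - H x| ≤ L * d (x j) a := by
  classical
  rcases isEmpty_or_nonempty (ι → E) with hE | hE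
  · exact ⟨0, G, le_rfl, hG, fun x => (hE.false x).elim, fun x => (hE.false x).elim⟩
  -- the summed weight
  set dT : (ι → E) → (ι → E) → ℝ := fun x y => ∑ i, d (x i) (y i) with hdT
  have hdTc : Continuous fun p : (ι → E) × (ι → E) => dT p.1 p.2 := by
    simp only [hdT]
    refine continuous_finsetSum _ fun i _ => ?_
    have h1 : Continuous fun p : (ι → E) × (ι → E) => (p.1 i, p.2 i) := by fun_prop
    exact hdc.comp h1
  have hdT0 : ∀ x, dT x x = 0 := fun x => by simp [hdT, hd0]
  have hdTnn : ∀ x y, 0 ≤ dT x y := fun x y => Finset.sum_nonneg fun i _ => hdnn _ _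
  have hdTsymm : ∀ x y, dT x y = dT y x := fun x y => by
    simp only [hdT]; exact Finset.sum_congr rfl fun i _ => hdsymm _ _
  have hdTtri : ∀ x y w, dT x w ≤ dT x y + dT y w := fun x y w => by
    simp only [hdT, ← Finset.sum_add_distrib]
    exact Finset.sum_le_sum fun i _ => hdtri _ _ _
  have hdTsep : ∀ x y, dT x y = 0 → x = y := fun x y h => by
    have h' : ∀ i ∈ Finset.univ, d (x i) (y i) = 0 :=
      (Finset.sum_eq_zero_iff_of_nonneg fun i _ => hdnn _ _).1 h
    funext i
    exact hdsep _ _ (h' i (Finset.mem_univ i))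
  have hdTupd : ∀ (x : ι → E) (j : ι) (a : E), dT x (update x j a) = d (x j) a := fun x j a => by
    simp only [hdT]
    rw [← Finset.sum_erase_add _ _ (Finset.mem_univ j), update_self]
    rw [Finset.sum_eq_zero fun i hi => ?_, zero_add]
    rw [update_of_ne (Finset.ne_of_mem_erase hi), hd0]
  -- the constant `L` from compactness of `K = {G y + δ ≤ G x}`
  set K : Set ((ι → E) × (ι → E)) := {p | G p.2 + δ ≤ G p.1} with hK
  have hKc : IsCompact K :=
    (isClosed_le (hG.comp continuous_snd |>.add continuous_const) (hG.comp continuous_fst)).isCompact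
  obtain ⟨L, hL0, hLK⟩ : ∃ L : ℝ, 0 ≤ L ∧ ∀ x y : ι → E, G x - δ ≤ G y + L * dT x y := by
    rcases K.eq_empty_or_nonempty with hKe | hKne
    · refine ⟨0, le_rfl, fun x y => ?_⟩
      have hxy : (x, y) ∉ K := by rw [hKe]; exact Set.notMem_empty _
      simp only [hK, Set.mem_setOf_eq, not_le] at hxy
      linarith
    · obtain ⟨p, hp, hmin⟩ := hKc.exists_isMinOn hKne hdTc.continuousOn
      have hp0 : 0 < dT p.1 p.2 := by
        rcases (hdTnn p.1 p.2).lt_or_eq with h | h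
        · exact h
        · exfalso
          have heq := hdTsep _ _ h.symm
          have hpK : G p.2 + δ ≤ G p.1 := hp
          rw [heq] at hpK
          linarith
      refine ⟨2 * MG / dT p.1 p.2, by positivity, fun x y => ?_⟩
      by_cases hxy : (x, y) ∈ K
      · have hle : dT p.1 p.2 ≤ dT x y := hmin hxy
        have h1 : 2 * MG ≤ 2 * MG / dT p.1 p.2 * dT x y := by
          rw [div_mul_eq_mul_div, le_div_iff₀ hp0]
          exact mul_le_mul_of_nonneg_left hle (by positivity)
        have h2 : G x - G y ≤ 2 * MG := by
          have := (abs_sub _ _ : |G x - G y| ≤ |G x| + |G y|)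
          linarith [le_abs_self (G x - G y), hMG x, hMG y]
        linarith
      · simp only [hK, Set.mem_setOf_eq, not_le] at hxy
        have : 0 ≤ 2 * MG / dT p.1 p.2 * dT x y := mul_nonneg (by positivity) (hdTnn x y)
        linarith
  -- the inf-convolution
  have hbdd : ∀ x, BddBelow (Set.range fun y => G y + L * dT x y) := fun x =>
    ⟨-MG, by
      rintro _ ⟨y, rfl⟩
      have := (abs_le.1 (hMG y)).1
      linarith [mul_nonneg hL0 (hdTnn x y)]⟩
  set H : (ι → E) → ℝ := fun x => ⨅ y, (G y + L * dT x y) with hH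
  have hHle : ∀ x, H x ≤ G x := fun x => by
    have := ciInf_le (hbdd x) x
    simp only [hdT0, mul_zero, add_zero] at this
    exact this
  have hHge : ∀ x, G x - δ ≤ H x := fun x => le_ciInf fun y => hLK x y
  have hHlip : ∀ x x', H x ≤ H x' + L * dT x x' := fun x x' => by
    have : H x - L * dT x x' ≤ H x' := by
      refine le_ciInf fun y => ?_
      have h1 : H x ≤ G y + L * dT x y := ciInf_le (hbdd x) y
      have h2 : dT x y ≤ dT x x' + dT x' y := hdTtri x x' y
      nlinarith [mul_le_mul_of_nonneg_left h2 hL0]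
    linarith
  have hHabs : ∀ x x', |H x - H x'| ≤ L * dT x x' := fun x x' => by
    rw [abs_sub_le_iff]
    constructor
    · linarith [hHlip x x']
    · have := hHlip x' x
      rw [hdTsymm x' x] at this
      linarith
  have hHc : Continuous H := by
    refine continuous_iff_continuousAt.2 fun x₀ => ?_
    rw [ContinuousAt, Metric.tendsto_nhds]
    intro ε hε
    have hct : ContinuousAt (fun x => L * dT x₀ x) x₀ :=
      ((continuous_const.mul (hdTc.comp (continuous_const.prodMk continuous_id))).continuousAt)
    have hlt : ∀ᶠ x in nhds x₀, L * dT x₀ x < ε := by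
      have h0 : L * dT x₀ x₀ < ε := by rw [hdT0, mul_zero]; exact hε
      exact hct.eventually (gt_mem_nhds h0)
    refine hlt.mono fun x hx => ?_
    rw [Real.dist_eq]
    calc |H x - H x₀| = |H x₀ - H x| := abs_sub_comm _ _
      _ ≤ L * dT x₀ x := hHabs x₀ x
      _ < ε := hx
  refine ⟨L, H, hL0, hHc, fun x => ?_, fun x j a => ?_⟩
  · rw [abs_sub_le_iff]
    constructor <;> linarith [hHle x, hHge x]
  · rw [abs_sub_comm]
    calc |H x - H (update x j a)| ≤ L * dT x (update x j a) := hHabs _ _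
      _ = L * d (x j) a := by rw [hdTupd]

end LipApprox

end HeatBath

end Summit.QuantumFields.YangMills.Theorems.StrongPinningPoincare

end
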